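import Summits.RiemannHypothesis.RiemannHypothesis.Theorems.WeilFormatCFamilyGram
import HarnessLib

/-!
# Format C, design C∞: toolkit for the family Gram — summability of the family squares, trigonometric product entries

Route context: Fourier–Galerkin / Schur-complement certificates of Weil positivity on a window ("format C";
cell memo `run/shared/lean/pub/rh-explicit/rh-explicit-weil-10/KERNEL-LEVER.md` §20; supporting stmt-RiemannHypothesis-0098;
seat rh-explicit-weil-10).  Small lemmas the C∞ rung generator instantiates when it feeds `sum_Ico_sq_sum_mul_le_of_boxes`
(`WeilFormatCFamilyGram`): the summability hypothesis `hφ` for every family function with `|φ(m)| ≤ C/m` on the tail (pure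
powers `m^{−(k+1)}`, `log m·m^{−(k+2)}`, the prime sums `C_m, S_m` times powers, the archimedean deviations, the polar pair),
and the reduction of products of oscillatory families to single-frequency tails (product-to-sum under `Σ'`), whose boxes are
the tree's Abel bounds (`WeilFormatCTrigTailSums`) transported by `abs_tsum_shift_le_of_partial`.

* `summable_sq_shift_of_abs_le_div` — `|φ(m)| ≤ C/m` for `m ≥ B₃ ≥ 1` ⇒ `Σ_k φ(B₃+k)²` summable;
* `summable_shift_of_abs_le_div_sq` — `|h(m)| ≤ C/m²` for `m ≥ B₃ ≥ 1` ⇒ `Σ_k h(B₃+k)` summable (entry products);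
* `abs_mul_le_div_sq_of_abs_le_div` — `|φ| ≤ C/m`, `|ψ| ≤ C'/m` ⇒ `|φψ| ≤ CC'/m²`;
* `tsum_mul_cos_mul_cos`, `tsum_mul_sin_mul_sin`, `tsum_mul_sin_mul_cos` — `Σ' g(m)cos(mθ)cos(mθ') = ½Σ' g cos(m(θ−θ')) +
  ½Σ' g cos(m(θ+θ'))` etc., for a weight `g` with `Σ'|g|`-type summability on the tail.

Pure real analysis; standard axioms; no definitions; no RH claim.
-/

set_option autoImplicit false
-- `Summit.RiemannHypothesis.RiemannHypothesis.…` is the layout-mandated namespace (summit = problem name).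
set_option linter.dupNamespace false

noncomputable section

open Finset Filter
open scoped BigOperators Topology

namespace Summit.RiemannHypothesis.RiemannHypothesis.Theorems.WeilFormatC

/-! ## Summability of the family squares and of the entry products -/

/-- **Entry products are summable**: `|h(m)| ≤ C/m²` for `m ≥ B₃ ≥ 1` ⇒ `Σ_k h(B₃+k)` summable. -/
theorem summable_shift_of_abs_le_div_sq {h : ℕ → ℝ} {B₃ : ℕ} (hB₃ : 1 ≤ B₃) {C : ℝ}
    (hh : ∀ m, B₃ ≤ m → |h m| ≤ C / (m : ℝ) ^ 2) : Summable fun k : ℕ ↦ h (B₃ + k) := by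
  have hC : 0 ≤ C := by
    have h1 := hh B₃ le_rfl
    have hB : (0 : ℝ) < B₃ := by exact_mod_cast hB₃
    have : 0 ≤ C / (B₃ : ℝ) ^ 2 := (abs_nonneg _).trans h1
    exact (div_nonneg_iff.1 this).elim (fun h ↦ h.1) fun h ↦ by nlinarith [h.2]
  -- compare with `C/(B₃+k)²`, itself dominated by the shifted `1/n²` series
  have hs : Summable fun k : ℕ ↦ C / ((B₃ : ℝ) + k) ^ 2 := by
    have h1 : Summable fun n : ℕ ↦ 1 / ((n : ℝ) + B₃) ^ 2 := by
      have := (summable_nat_add_iff B₃).2 (Real.summable_one_div_nat_pow.2 one_lt_two)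
      refine this.congr fun n ↦ ?_
      push_cast
      ring_nf
    refine (h1.mul_left C).congr fun k ↦ ?_
    rw [add_comm (k : ℝ)]
    ring
  refine Summable.of_norm_bounded hs fun k ↦ ?_
  rw [Real.norm_eq_abs]
  have := hh (B₃ + k) (Nat.le_add_right _ _)
  push_cast at this
  exact this

/-- **Family squares are summable**: `|φ(m)| ≤ C/m` for `m ≥ B₃ ≥ 1` ⇒ `Σ_k φ(B₃+k)²` summable (the hypothesis `hφ` of
`sum_Ico_sq_sum_mul_le_of_boxes`). -/
theorem summable_sq_shift_of_abs_le_div {φ : ℕ → ℝ} {B₃ : ℕ} (hB₃ : 1 ≤ B₃) {C : ℝ}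
    (hφ : ∀ m, B₃ ≤ m → |φ m| ≤ C / (m : ℝ)) : Summable fun k : ℕ ↦ φ (B₃ + k) ^ 2 := by
  refine summable_shift_of_abs_le_div_sq (h := fun m ↦ φ m ^ 2) hB₃ (C := C ^ 2) fun m hm ↦ ?_
  have hm0 : (0 : ℝ) < m := by exact_mod_cast hB₃.trans hm
  have h := hφ m hm
  have hC : 0 ≤ C / (m : ℝ) := (abs_nonneg _).trans h
  rw [abs_of_nonneg (sq_nonneg _), ← sq_abs, show C ^ 2 / (m : ℝ) ^ 2 = (C / m) ^ 2 by rw [div_pow]]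
  exact pow_le_pow_left₀ (abs_nonneg _) h 2

/-- **Products of two `1/m`-families**: `|φ(m)| ≤ C/m`, `|ψ(m)| ≤ C'/m` ⇒ `|φ(m)ψ(m)| ≤ CC'/m²` (`m ≥ 1`). -/
theorem abs_mul_le_div_sq_of_abs_le_div {φm ψm C C' : ℝ} {m : ℕ} (hm : 1 ≤ m) (hφ : |φm| ≤ C / (m : ℝ))
    (hψ : |ψm| ≤ C' / (m : ℝ)) : |φm * ψm| ≤ C * C' / (m : ℝ) ^ 2 := by
  have hm0 : (0 : ℝ) < m := by exact_mod_cast hm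
  have hC : 0 ≤ C / (m : ℝ) := (abs_nonneg _).trans hφ
  rw [abs_mul]
  calc |φm| * |ψm| ≤ (C / m) * (C' / m) := mul_le_mul hφ hψ (abs_nonneg _) hC
    _ = C * C' / (m : ℝ) ^ 2 := by rw [sq]; field_simp

/-! ## Products of oscillatory families under `Σ'` -/

/-- **`cos·cos` entries**: for a weight `g` with `Σ_k |g(M+k)|` summable,
`Σ'_k g(M+k)cos((M+k)θ)cos((M+k)θ') = ½Σ'_k g(M+k)cos((M+k)(θ−θ')) + ½Σ'_k g(M+k)cos((M+k)(θ+θ'))`. -/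
theorem tsum_mul_cos_mul_cos (g : ℕ → ℝ) (M : ℕ) (hg : Summable fun k : ℕ ↦ |g (M + k)|) (θ θ' : ℝ) :
    ∑' k : ℕ, g (M + k) * Real.cos ((M + k : ℕ) * θ) * Real.cos ((M + k : ℕ) * θ')
      = (∑' k : ℕ, g (M + k) * Real.cos ((M + k : ℕ) * (θ - θ'))) / 2
        + (∑' k : ℕ, g (M + k) * Real.cos ((M + k : ℕ) * (θ + θ'))) / 2 := by
  have hb : ∀ φ : ℝ, Summable fun k : ℕ ↦ g (M + k) * Real.cos ((M + k : ℕ) * φ) := fun φ ↦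
    Summable.of_norm_bounded hg fun k ↦ by
      rw [Real.norm_eq_abs, abs_mul]
      exact mul_le_of_le_one_right (abs_nonneg _) (Real.abs_cos_le_one _)
  rw [← tsum_div_const, ← tsum_div_const, ← (hb _).div_const 2 |>.tsum_add ((hb _).div_const 2)]
  refine tsum_congr fun k ↦ ?_
  rw [mul_sub, mul_add, Real.cos_sub, Real.cos_add]
  ring

/-- **`sin·sin` entries**: `Σ' g sin(mθ)sin(mθ') = ½Σ' g cos(m(θ−θ')) − ½Σ' g cos(m(θ+θ'))`. -/
theorem tsum_mul_sin_mul_sin (g : ℕ → ℝ) (M : ℕ) (hg : Summable fun k : ℕ ↦ |g (M + k)|) (θ θ' : ℝ) :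
    ∑' k : ℕ, g (M + k) * Real.sin ((M + k : ℕ) * θ) * Real.sin ((M + k : ℕ) * θ')
      = (∑' k : ℕ, g (M + k) * Real.cos ((M + k : ℕ) * (θ - θ'))) / 2
        - (∑' k : ℕ, g (M + k) * Real.cos ((M + k : ℕ) * (θ + θ'))) / 2 := by
  have hb : ∀ φ : ℝ, Summable fun k : ℕ ↦ g (M + k) * Real.cos ((M + k : ℕ) * φ) := fun φ ↦
    Summable.of_norm_bounded hg fun k ↦ by
      rw [Real.norm_eq_abs, abs_mul]
      exact mul_le_of_le_one_right (abs_nonneg _) (Real.abs_cos_le_one _)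
  rw [← tsum_div_const, ← tsum_div_const, ← (hb _).div_const 2 |>.tsum_sub ((hb _).div_const 2)]
  refine tsum_congr fun k ↦ ?_
  rw [mul_sub, mul_add, Real.cos_sub, Real.cos_add]
  ring

/-- **`sin·cos` entries**: `Σ' g sin(mθ)cos(mθ') = ½Σ' g sin(m(θ+θ')) + ½Σ' g sin(m(θ−θ'))`. -/
theorem tsum_mul_sin_mul_cos (g : ℕ → ℝ) (M : ℕ) (hg : Summable fun k : ℕ ↦ |g (M + k)|) (θ θ' : ℝ) :
    ∑' k : ℕ, g (M + k) * Real.sin ((M + k : ℕ) * θ) * Real.cos ((M + k : ℕ) * θ')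
      = (∑' k : ℕ, g (M + k) * Real.sin ((M + k : ℕ) * (θ + θ'))) / 2
        + (∑' k : ℕ, g (M + k) * Real.sin ((M + k : ℕ) * (θ - θ'))) / 2 := by
  have hb : ∀ φ : ℝ, Summable fun k : ℕ ↦ g (M + k) * Real.sin ((M + k : ℕ) * φ) := fun φ ↦
    Summable.of_norm_bounded hg fun k ↦ by
      rw [Real.norm_eq_abs, abs_mul]
      exact mul_le_of_le_one_right (abs_nonneg _) (Real.abs_sin_le_one _)
  rw [← tsum_div_const, ← tsum_div_const, ← (hb _).div_const 2 |>.tsum_add ((hb _).div_const 2)]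
  refine tsum_congr fun k ↦ ?_
  rw [mul_add, mul_sub, Real.sin_add, Real.sin_sub]
  ring

end Summit.RiemannHypothesis.RiemannHypothesis.Theorems.WeilFormatC
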